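import Summits.ABC.IUTFork.Cor312SzpiroBadVsDepth
import Summits.ABC.IUTFork.Cor312LicenceShallowGenuineK
import Literature.IUT.LogVolume.Corollary22PartIIPointwise
import Literature.IUT.LogVolume.GenuineLogThetaPoint
import Literature.IUT.LogVolume.PilotDataBaseChange
import HarnessLib

/-!
# R-W lane U, task T4 (sequel): the window criterion read at the `λ`-line point — «every bad local height `h_v ≤ 16·e_v`» makes
# EVERY Θ-volume datum at `(P, l)` shallow at EVERY packet, for EVERY `l`

PROOF-ONLY sequel (no `def`, no new `Prop`) of `Cor312SzpiroBadVsDepth.lean` (abc-iut-w4-d078 g6, p457542), D-0079 R-W task T4 of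
`plan/W/WINDOW-SPEC.md` §2b.  TAKES NO SIDE on [IUTchIII] Cor. 3.12 or on any author.

There, §1 spoke about the local heights `h_v` of the point `P = (F_tpd, λ)` (Szpiro side) and §2 about `−ord_{x₀}(j_E)` and `e_{x₀}` at the
places `x₀` of the field `K` of an initial Θ-datum (depth side).  This file identifies the two along the tower `F_tpd ⊆ F ⊆ K` of a
Θ-volume datum (`j(E_F) = j(λ)`; `ord_{x₀}(j_E) = e(x₀|v₁)·e(v₁|v)·ord_v(j(λ))` and `e_{x₀} = e(x₀|v₁)·e(v₁|v)·e_v` by the tree's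
`ord_algebraMap` and `ramIdx_eq_ramIdx_finBelow_mul`), so that the depth-side criterion becomes a statement about `P` alone:

* `GenuineK.neg_ord_jE_le_of_forall_localHeight_le` — if every bad place `v` of `F_tpd` has `h_v ≤ 16·e_v`, then for ANY initial
  Θ-datum `D` over `F ⊆ K` with `j(E_F) = j(λ)`, every place `x₀` of `K` has `−ord_{x₀}(j_E) ≤ 16·e_{x₀}`;
* `GenuineK.not_deepOrd_of_forall_localHeight_le` / `…not_deep_of_forall_localHeight_le` — hence `¬DeepOrd(D)` / `¬Deep(D)`
  (abc-iut-C-cert-2's `GenuineK.deep_iff_deepOrd` forms, p445646), whatever `l ≥ 5` and `K` are;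
* `Cor22.ThetaVolumeDatumAt.not_deep_of_forall_localHeight_le` — at a genuine Θ-volume datum `T : Cor22.ThetaVolumeDatumAt P l`: the
  depth antecedent `¬(∃ pp > 2, i, x₀, …‖t_{q,x₀}‖… < 1)` of the binder `hSHwBad` of the cut of record `Conditional.abc_of_SH_v10K_window_szpiroBadBoth`
  (abc-iut-c312-d1 p450130) HOLDS, VERBATIM, for every `T` at such a point.

READING for the window table (numbers, no side): the set «all bad `h_v ≤ 16·e_v`» is WINDOW-PERMANENT — none of its Θ-volume data is ever
on the degree-form depth locus, at any `l`; together with p457542 §1 (Szpiro-bad needs only SOME `h_v > c₁(1−1/l) ≤ 8`) the Szpiro-bad part of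
this set (e.g. every bad `h_v ∈ (8, 16]`) is exactly where `hSHwBad` keeps content.  Nothing here asserts the existence of any datum, nor
`Cor312Of` for any datum; typed ≠ proved.
[cite: Mochizuki2012, IUTchIV Thm. 1.10 p. 22–23, Cor. 2.2 (ii) proof (P2)(P5) p. 45–46; IUTchI Def. 3.1 (b)(c) p. 61]
[cite: DupuyHilado2025, §3.3, §3.4] [claim: Mochizuki2012, status: disputed]
-/

noncomputable section

open Set Function NumberField IsDedekindDomain

namespace Summit.ABC.IUTFork.Conditional

open Thm311 Thm311.Real Cor312 Cor312Vol Cor312Prov Literature.IUT.LogThetaLattice Literature.IUT.LogVolume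
  Literature.IUT.HodgeTheaters Literature.IUT.LogVolume.ThetaData
open Literature.NumberTheory.DiophantineGeometry.GenEll Summit.ABC.ABC.Theorems

variable {P : NFPoint} {F K Fbar : Type} [Field F] [NumberField F] [Algebra P.F F] [Field K] [NumberField K] [Algebra F K]
  [Field Fbar] [Algebra F Fbar] [Algebra K Fbar] {E : WeierstrassCurve F} [E.IsElliptic] {l : ℕ} {Pb : BadPlacePredicates K}

/-- **The cross-field identification**: along `F_tpd ⊆ F ⊆ K` with `j(E_F) = j(λ)`, if every bad place `v` of `F_tpd` (pole of `j(λ)`) has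
local height `h_v ≤ 16·e_v`, then EVERY finite place `x₀` of `K` has `−ord_{x₀}(j_E) ≤ 16·e_{x₀}` (`ord_{x₀}(j_E) = e(x₀|v₁)e(v₁|v)·ord_v(j(λ))`,
`e_{x₀} = e(x₀|v₁)e(v₁|v)·e_v`; at a place over a non-pole `−ord ≤ 0`). [cite: Mochizuki2012, IUTchI Def. 3.1 (b)(c) p. 61]
[claim: Mochizuki2012, status: disputed] -/
theorem GenuineK.neg_ord_jE_le_of_forall_localHeight_le (hj : E.j = algebraMap P.F F (Cor22.jInv P.x))
    (h16 : ∀ v ∈ Cor22.badPlaces P, Cor22.localHeight P v ≤ 16 * ramIdx P.F v) (x₀ : HeightOneSpectrum (𝓞 K)) :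
    (-(ord K x₀ (algebraMap F K E.j) : ℝ)) ≤ 16 * ramIdx K x₀ := by
  set v₁ := finBelow F K x₀ with hv₁
  set v₀ := finBelow P.F F v₁ with hv₀
  have e₁pos : 0 < Ideal.ramificationIdx' v₁.asIdeal x₀.asIdeal := PilotData.ramificationIdx'_finBelow_pos (F := F) x₀
  have e₀pos : 0 < Ideal.ramificationIdx' v₀.asIdeal v₁.asIdeal := PilotData.ramificationIdx'_finBelow_pos (F := P.F) v₁
  have hord : ord K x₀ (algebraMap F K E.j) =
      (Ideal.ramificationIdx' v₁.asIdeal x₀.asIdeal : ℤ) * ((Ideal.ramificationIdx' v₀.asIdeal v₁.asIdeal : ℤ) *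
        ord P.F v₀ (Cor22.jInv P.x)) := by
    rw [hj, ord_algebraMap F K x₀, ord_algebraMap P.F F v₁]
  have hram : (ramIdx K x₀ : ℝ) =
      (ramIdx P.F v₀ : ℝ) * (Ideal.ramificationIdx' v₀.asIdeal v₁.asIdeal : ℝ) * (Ideal.ramificationIdx' v₁.asIdeal x₀.asIdeal : ℝ) := by
    rw [ramIdx_eq_ramIdx_finBelow_mul (F := F) (K := K) x₀, ramIdx_eq_ramIdx_finBelow_mul (F := P.F) (K := F) v₁]
    push_cast
    ring
  have e₁r : (0 : ℝ) < (Ideal.ramificationIdx' v₁.asIdeal x₀.asIdeal : ℝ) := by exact_mod_cast e₁pos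
  have e₀r : (0 : ℝ) < (Ideal.ramificationIdx' v₀.asIdeal v₁.asIdeal : ℝ) := by exact_mod_cast e₀pos
  have hr0 : (0 : ℝ) ≤ (ramIdx P.F v₀ : ℝ) := Nat.cast_nonneg _
  rw [hord, hram]
  push_cast
  by_cases hneg : ord P.F v₀ (Cor22.jInv P.x) < 0
  · -- a bad place below: `h_{v₀} = −ord_{v₀}(j(λ)) ≤ 16·e_{v₀}`
    have hv₀bad : v₀ ∈ Cor22.badPlaces P := (Cor22.mem_badPlaces_iff_ord_neg P v₀).mpr hneg
    have hh := h16 v₀ hv₀bad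
    rw [Cor22.localHeight_eq_neg_ord hv₀bad] at hh
    have hprod : (0 : ℝ) ≤ (Ideal.ramificationIdx' v₁.asIdeal x₀.asIdeal : ℝ) * (Ideal.ramificationIdx' v₀.asIdeal v₁.asIdeal : ℝ) :=
      mul_nonneg e₁r.le e₀r.le
    nlinarith [mul_le_mul_of_nonneg_left hh hprod]
  · -- a good place below: `−ord ≤ 0`
    have h0 : (0 : ℝ) ≤ (ord P.F v₀ (Cor22.jInv P.x) : ℝ) := by exact_mod_cast not_lt.mp hneg
    have : (0 : ℝ) ≤ (Ideal.ramificationIdx' v₁.asIdeal x₀.asIdeal : ℝ) * ((Ideal.ramificationIdx' v₀.asIdeal v₁.asIdeal : ℝ) *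
        (ord P.F v₀ (Cor22.jInv P.x) : ℝ)) := mul_nonneg e₁r.le (mul_nonneg e₀r.le h0)
    nlinarith [mul_nonneg (mul_nonneg hr0 e₀r.le) e₁r.le]

/-- **The window criterion at the point, `DeepOrd` form**: if every bad place `v` of `F_tpd` has `h_v ≤ 16·e_v`, then for ANY initial Θ-datum
`D` over `F ⊆ K` with `j(E_F) = j(λ)` (any `l ≥ 5`, any `K`), `¬DeepOrd(D)` — the right-hand side of abc-iut-C-cert-2's
`GenuineK.deep_iff_deepOrd` (p445646) fails: no packet `(p > 2, i, x₀)` is on the degree-form depth locus (p457542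
`GenuineK.not_deepOrd_of_neg_ord_jE_le` + the identification above). [claim: Mochizuki2012, status: disputed]
[cite: Mochizuki2012, IUTchIV Thm. 1.10 p. 22–23] [cite: DupuyHilado2025, §3.4] -/
theorem GenuineK.not_deepOrd_of_forall_localHeight_le (D : InitialThetaData F K Fbar E l Pb)
    (hj : E.j = algebraMap P.F F (Cor22.jInv P.x)) (h16 : ∀ v ∈ Cor22.badPlaces P, Cor22.localHeight P v ≤ 16 * ramIdx P.F v) :
    ¬ (∃ (pp : Nat.Primes) (_ : 2 < (pp : ℕ)) (i : Fin (thetaIndex (pilotDataOfK D K)).lstar)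
        (x₀ : (thetaIndex (pilotDataOfK D K)).Fibre (.inr pp)),
      haveI : Fact (pp : ℕ).Prime := ⟨pp.2⟩
      placeOf (pilotDataOfK D K) pp.1 x₀ ∈ (pilotDataOfK D K).S ∧
      ((pp : ℕ) : ℝ) ^ ((((i : ℕ) : ℝ) + 2) * (4 + 2 * Real.logb (pp : ℕ) (Module.finrank ℚ K)) + 1) *
        (((pp : ℕ) : ℝ) ^ ((ord K (placeOf (pilotDataOfK D K) pp.1 x₀) (algebraMap F K E.j) : ℝ) /
          (2 * l * ramIdx K (placeOf (pilotDataOfK D K) pp.1 x₀)))) ^ (((i : ℕ) + 1) ^ 2 - 1) < 1) :=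
  GenuineK.not_deepOrd_of_neg_ord_jE_le D fun _ _ _ =>
    GenuineK.neg_ord_jE_le_of_forall_localHeight_le (K := K) hj h16 _

/-- **The window criterion at the point, chosen-q-idele `Deep` form** (the v8K/v10K window of abc-iut-C-cert-1 and C-cert-3): every bad `h_v ≤ 16·e_v`
⟹ for ANY initial Θ-datum `D` at the point, no packet satisfies `p^{((i+2)(4+2·log_p[K:ℚ]))+1}·‖t_{q,x₀}‖^{(i+1)²−1} < 1`.
[claim: Mochizuki2012, status: disputed] [cite: DupuyHilado2025, §3.4] -/
theorem GenuineK.not_deep_of_forall_localHeight_le (D : InitialThetaData F K Fbar E l Pb)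
    (hj : E.j = algebraMap P.F F (Cor22.jInv P.x)) (h16 : ∀ v ∈ Cor22.badPlaces P, Cor22.localHeight P v ≤ 16 * ramIdx P.F v) :
    ¬ (∃ (pp : Nat.Primes) (_ : 2 < (pp : ℕ)) (i : Fin (thetaIndex (pilotDataOfK D K)).lstar)
        (x₀ : (thetaIndex (pilotDataOfK D K)).Fibre (.inr pp)),
      haveI : Fact (pp : ℕ).Prime := ⟨pp.2⟩
      ((pp : ℕ) : ℝ) ^ ((((i : ℕ) : ℝ) + 2) * (4 + 2 * Real.logb (pp : ℕ) (Module.finrank ℚ K)) + 1) *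
        ‖(exists_realising_qIdeles_pilotDataOfK D).choose pp x₀‖ ^ (((i : ℕ) + 1) ^ 2 - 1) < 1) :=
  GenuineK.not_deep_of_neg_ord_jE_le D fun _ _ _ =>
    GenuineK.neg_ord_jE_le_of_forall_localHeight_le (K := K) hj h16 _

end Summit.ABC.IUTFork.Conditional

/-! ## At a genuine Θ-volume datum: the depth antecedent of `hSHwBad` (p450130) holds verbatim -/

namespace Literature.IUT.LogVolume.Cor22.ThetaVolumeDatumAt

open Literature.NumberTheory.DiophantineGeometry.GenEll Summit.ABC.IUTFork Summit.ABC.IUTFork.Thm311.Real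
  Summit.ABC.IUTFork.Cor312Prov Summit.ABC.IUTFork.Conditional Literature.IUT.HodgeTheaters

variable {P : NFPoint} {l : ℕ} (T : ThetaVolumeDatumAt P l)

/-- **WINDOW-PERMANENCE at a `λ`-line point** (R-W lane U, T4 sequel): if every bad place `v` of `F_tpd` has local height `h_v ≤ 16·e_v`, then
for EVERY genuine Θ-volume datum `T` at `(P, l)` the depth antecedent of the binder `hSHwBad` of the cut of record
`Conditional.abc_of_SH_v10K_window_szpiroBadBoth` (abc-iut-c312-d1 p450130) — `¬ (∃ pp > 2, i, x₀, p^{…}·‖t_{q,x₀}‖^{(i+1)²−1} < 1)` on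
the chosen realising q-idele of `T.D` — HOLDS, VERBATIM: the datum is in the window at every packet (`T.j_eq` supplies `j(E_F) = j(λ)`).
So at such points `hSHwBad` is demanded as soon as `(P, l)` is admissible and Szpiro-bad (by p457542 §1 that needs only one `h_v > c₁(1−1/l) ≤ 8`).
[cite: Mochizuki2012, IUTchIII Cor. 3.12 p. 173–174; IUTchIV Thm. 1.10 p. 22–23] [claim: Mochizuki2012, status: disputed] -/
theorem not_deep_of_forall_localHeight_le (h16 : ∀ v ∈ badPlaces P, localHeight P v ≤ 16 * ramIdx P.F v) :
    letI := T.instFieldF; letI := T.instNumberFieldF; letI := T.instAlgebraF; letI := T.instFieldK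
    letI := T.instNumberFieldK; letI := T.instAlgebraK; letI := T.instFieldFbar; letI := T.instAlgebraFbar
    letI := T.instAlgebraKFbar; letI := T.instIsElliptic
    ¬ (∃ (pp : Nat.Primes) (_ : 2 < (pp : ℕ)) (i : Fin (thetaIndex (pilotDataOfK T.D T.K)).lstar)
        (x₀ : (thetaIndex (pilotDataOfK T.D T.K)).Fibre (.inr pp)),
      haveI : Fact (pp : ℕ).Prime := ⟨pp.2⟩
      ((pp : ℕ) : ℝ) ^ ((((i : ℕ) : ℝ) + 2) * (4 + 2 * Real.logb (pp : ℕ) (Module.finrank ℚ T.K)) + 1) *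
        ‖(exists_realising_qIdeles_pilotDataOfK T.D).choose pp x₀‖ ^ (((i : ℕ) + 1) ^ 2 - 1) < 1) := by
  letI := T.instFieldF; letI := T.instNumberFieldF; letI := T.instAlgebraF; letI := T.instFieldK
  letI := T.instNumberFieldK; letI := T.instAlgebraK; letI := T.instFieldFbar; letI := T.instAlgebraFbar
  letI := T.instAlgebraKFbar; letI := T.instIsElliptic
  exact GenuineK.not_deep_of_forall_localHeight_le T.D T.j_eq h16

end Literature.IUT.LogVolume.Cor22.ThetaVolumeDatumAt

end
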